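import Literature.NumberTheory.LFunctions.MertensBoundSoundararajan
import Mathlib.NumberTheory.Harmonic.Bounds
import HarnessLib

/-!
# `M_N(iτ) ≪ N^{1/2}|τ|^{1/2−κ(τ)}` under RH, from the engine of Soundararajan's method (Balazard–de Roton 2010, Prop. 12)

Topic `Literature/NumberTheory/LFunctions`; the last brick of the reduction of
`Literature.NumberTheory.LFunctions.BalazardDeRoton2010_thm1` to the engine statements of
Soundararajan's method. M. Balazard, A. de Roton, arXiv:0812.1689, §6.2:

> **Proposition 12.** Pour `0 < δ ≤ 1/12`, `N` assez grand et
> `exp(3(log N)^{1/2}(log log N)^{5/2+6δ}) ≤ |τ| ≤ N^{3/4}`, on a `M_N(iτ) ≪ N^{1/2}|τ|^{1/2−κ(τ)}`,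
> où `κ(τ) = ½ log log log|τ|/log log|τ|`.

The printed proof: Perron ((t45), `MoebiusTwistPerron.lean`), the path `𝒮_N` and Cauchy's theorem
(`SoundararajanContour.lean`), the part of `𝒮_N` far from `iτ` bounded by the untwisted estimate
((t46): `SoundararajanContourDyadic.lean`), and on the near part `|(Im z − τ)/τ| ≤ 1/4` the bounds
`|z − iτ|⁻¹ ≪ (1+|n−τ|)⁻¹` ("donc l'intégrale est en `O(log τ)`", here `near_harmonic_le`) and
`|ζ(z)⁻¹N^z| ≤ √N exp(V log(log N/log Im z) + (2+3δ)V log log V)` with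
`V ≤ ½ log τ/log log τ + … ` and `log N/log|τ| ≤ log|τ|/(log log|τ|)^5` (here, with Prop. 18's
coefficient `1`, through the full power `(log log|τ|)^{5+12δ}`: `near_exponent_le`). As in
`MertensBoundSoundararajan.lean` the conclusions of Balazard–de Roton 2008 Props. 1, 18, 20 are
hypotheses; the output `SoundContour.moebiusSum_twist_bound_of_engine` is exactly hypothesis `h12` of
`Literature.NumberTheory.LFunctions.BalazardDeRoton2010_thm1_of_deep`.

## References

* [BalazardDeRoton2010] M. Balazard, A. de Roton, arXiv:0812.1689, Prop. 12 and §6.2 (pp. 8–9).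
* [BalazardRoton2008] M. Balazard, A. de Roton, arXiv:0810.3587, §8.
-/

noncomputable section

open Complex Real Filter Finset Topology Asymptotics

namespace Literature.NumberTheory.LFunctions

namespace SoundContour

open Soundararajan TypicalLadder TypicalPointwise TypicalCounting TypicalLevelSets
open BalazardDeRoton BaezDuarteOnlyIf MoebiusTwistPerron

/-! ### "`τ` assez grand" -/

/-- The largeness conditions on the height `t = |τ|` (`ℓ = log t`, `ℓ₂ = log ℓ`, `ℓ₃ = log ℓ₂`) used in
the near-ordinate analysis; all hold for `t` large (`exists_largeT`). [folklore] -/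
structure LargeT (δ D₂ KP : ℝ) (t : ℝ) : Prop where
  t8 : 8 ≤ t
  l2 : 3 ≤ Real.log (Real.log t)
  l3 : 1 ≤ Real.log (Real.log (Real.log t))
  a1 : 8 * Real.log (Real.log (Real.log t)) ≤ δ * Real.log (Real.log t)
  a2 : 2 * D₂ * δ⁻¹ ^ 3 ≤ Real.log (Real.log (Real.log t))
  a3 : 10 * (Real.log (Real.log (Real.log t)) + 3) * Real.log (Real.log t) ^ 2 ≤
    δ * Real.log t * Real.log (Real.log (Real.log t))
  a4 : 72 * Real.log (Real.log t) ^ 6 ≤ Real.log t ^ 2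
  a5 : 1 ≤ δ * Real.log (Real.log t) * Real.log (Real.log (Real.log t))
  a6 : (1 + δ) * Real.log t * Real.log (Real.log (Real.log t)) / Real.log (Real.log t) ^ 2 +
    Real.log (Real.log (Real.log t)) + 3 ≤ Real.log t / (2 * Real.log (Real.log t))
  a8 : 1 / 4 + 4 / Real.log (Real.log t) + 4 * Real.log (Real.log t) / Real.log t ≤ Real.log (Real.log t) ^ 2
  a9 : Real.log 96 + Real.log (Real.log t) ≤
    2 * δ * Real.log t * Real.log (Real.log (Real.log t)) / Real.log (Real.log t)
  a10 : 2 * KP * Real.log t ^ 2 ≤ Real.exp (Real.log t / 12)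

section near

variable {δ D₂ KP t : ℝ}

/-- Basic sizes under `LargeT`: `t > 1`, `ℓ ≥ 16`, `ℓ₂ > 0`, `ℓ₃ > 0`, `4ℓ₂ ≤ ℓ`, `ℓ₃ ≤ ℓ₂`.
[folklore] -/
lemma largeT_sizes (h : LargeT δ D₂ KP t) :
    1 < t ∧ 16 ≤ Real.log t ∧ 0 < Real.log (Real.log t) ∧ 0 < Real.log (Real.log (Real.log t)) ∧
      4 * Real.log (Real.log t) ≤ Real.log t ∧ Real.log (Real.log (Real.log t)) ≤ Real.log (Real.log t) := by
  have ht1 : 1 < t := by linarith [h.t8]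
  have hl2 := h.l2
  have hl3 := h.l3
  have hℓ0 : 0 < Real.log t := Real.log_pos ht1
  have hℓ20 : 16 ≤ Real.log t := by
    have h1 : Real.exp 3 ≤ Real.log t := by
      rw [← Real.log_le_log_iff (Real.exp_pos 3) hℓ0, Real.log_exp]; exact hl2
    have h2 : (16 : ℝ) ≤ Real.exp 3 := by
      have he : (2.7 : ℝ) ≤ Real.exp 1 := by have := Real.exp_one_gt_d9; linarith
      have h3 : (2.7 : ℝ) ^ 3 ≤ Real.exp 1 ^ 3 := pow_le_pow_left₀ (by norm_num) he 3
      rw [Real.exp_one_pow 3] at h3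
      norm_num at h3 ⊢
      linarith
    linarith
  have hℓ₂0 : 0 < Real.log (Real.log t) := by linarith
  refine ⟨ht1, hℓ20, hℓ₂0, by linarith, ?_, ?_⟩
  · have h4 := h.a4
    have hℓ₂4 : (3 : ℝ) ^ 4 ≤ Real.log (Real.log t) ^ 4 := pow_le_pow_left₀ (by norm_num) hl2 4
    have e : Real.log (Real.log t) ^ 6 = Real.log (Real.log t) ^ 4 * Real.log (Real.log t) ^ 2 := by ring
    have h16 : (4 * Real.log (Real.log t)) ^ 2 ≤ Real.log t ^ 2 := by nlinarith
    exact (pow_le_pow_iff_left₀ (by positivity) hℓ0.le two_ne_zero).1 h16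
  · exact (Real.log_le_sub_one_of_pos hℓ₂0).trans (by linarith)

/-- **"`τ` assez grand": `LargeT` holds beyond some threshold.** [folklore] -/
theorem exists_largeT (δ D₂ KP : ℝ) (hδ0 : 0 < δ) : ∃ t₄ : ℝ, ∀ t : ℝ, t₄ ≤ t → LargeT δ D₂ KP t := by
  -- everything along `ℓ = log t → ∞`
  have hL := Real.tendsto_log_atTop
  have hL₂ : Tendsto (fun t : ℝ ↦ Real.log (Real.log t)) atTop atTop := tendsto_loglog_atTop
  have hL₃ : Tendsto (fun t : ℝ ↦ Real.log (Real.log (Real.log t))) atTop atTop := tendsto_logloglog_atTop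
  have c0 : ∀ᶠ t : ℝ in atTop, 8 ≤ t := eventually_ge_atTop 8
  have c1 : ∀ᶠ t : ℝ in atTop, 3 ≤ Real.log (Real.log t) := hL₂.eventually_ge_atTop 3
  have c2 : ∀ᶠ t : ℝ in atTop, 1 ≤ Real.log (Real.log (Real.log t)) := hL₃.eventually_ge_atTop 1
  -- `a1`: `8ℓ₃ ≤ δℓ₂`
  have c3 : ∀ᶠ t : ℝ in atTop, 8 * Real.log (Real.log (Real.log t)) ≤ δ * Real.log (Real.log t) := by
    have := hL₂.eventually (eventually_log_le_mul (show 0 < δ / 8 by positivity))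
    filter_upwards [this] with t ht
    linarith
  have c4 : ∀ᶠ t : ℝ in atTop, 2 * D₂ * δ⁻¹ ^ 3 ≤ Real.log (Real.log (Real.log t)) :=
    hL₃.eventually_ge_atTop _
  -- `ℓ₂² ≤ ε ℓ` type bounds (for `a3`, `a6`, `a8`, `a9`)
  have csq : ∀ ε : ℝ, 0 < ε → ∀ᶠ t : ℝ in atTop, Real.log (Real.log t) ^ 2 ≤ ε * Real.log t := by
    intro ε hε
    have := hL.eventually (eventually_log_pow_le_mul_sqrt 2 hε)
    filter_upwards [this, hL.eventually_ge_atTop (1 : ℝ)] with t ht hℓ1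
    have : Real.log t ^ (1 / 2 : ℝ) ≤ Real.log t := by
      calc Real.log t ^ (1 / 2 : ℝ) ≤ Real.log t ^ (1 : ℝ) :=
            Real.rpow_le_rpow_of_exponent_le hℓ1 (by norm_num)
        _ = Real.log t := Real.rpow_one _
    nlinarith
  -- `a3`: `10(ℓ₃+3)ℓ₂² ≤ δℓℓ₃` from `ℓ₃ ≥ 1` and `40 ℓ₂² ≤ δ ℓ`
  have c5 : ∀ᶠ t : ℝ in atTop, 10 * (Real.log (Real.log (Real.log t)) + 3) * Real.log (Real.log t) ^ 2 ≤
      δ * Real.log t * Real.log (Real.log (Real.log t)) := by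
    filter_upwards [csq (δ / 40) (by positivity), c2] with t ht h3
    have h0 : 0 ≤ Real.log (Real.log t) ^ 2 := sq_nonneg _
    nlinarith
  -- `a4`: `72 ℓ₂⁶ ≤ ℓ²`
  have c6 : ∀ᶠ t : ℝ in atTop, 72 * Real.log (Real.log t) ^ 6 ≤ Real.log t ^ 2 := by
    have := hL.eventually (eventually_log_pow_le_mul_sqrt 6 (show (0 : ℝ) < 1 / 72 by norm_num))
    filter_upwards [this, hL.eventually_ge_atTop (1 : ℝ)] with t ht hℓ1
    have : Real.log t ^ (1 / 2 : ℝ) ≤ Real.log t ^ 2 := by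
      calc Real.log t ^ (1 / 2 : ℝ) ≤ Real.log t ^ ((2 : ℕ) : ℝ) :=
            Real.rpow_le_rpow_of_exponent_le hℓ1 (by norm_num)
        _ = Real.log t ^ 2 := Real.rpow_natCast _ 2
    nlinarith
  -- `a5`
  have c7 : ∀ᶠ t : ℝ in atTop, 1 ≤ δ * Real.log (Real.log t) * Real.log (Real.log (Real.log t)) := by
    filter_upwards [hL₂.eventually_ge_atTop δ⁻¹, c2] with t h2 h3
    have : 1 ≤ δ * Real.log (Real.log t) := by
      have := mul_le_mul_of_nonneg_left h2 hδ0.le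
      rwa [mul_inv_cancel₀ hδ0.ne'] at this
    nlinarith
  -- `a6`: from `4(1+δ)ℓ₃ ≤ ℓ₂` and `16 ℓ₂² ≤ ℓ`
  have c8 : ∀ᶠ t : ℝ in atTop, (1 + δ) * Real.log t * Real.log (Real.log (Real.log t)) / Real.log (Real.log t) ^ 2 +
      Real.log (Real.log (Real.log t)) + 3 ≤ Real.log t / (2 * Real.log (Real.log t)) := by
    have e1 := hL₂.eventually (eventually_log_le_mul (show 0 < 1 / (4 * (1 + δ)) by positivity))
    filter_upwards [e1, csq (1 / 16) (by norm_num), c1, c2, hL.eventually_ge_atTop (1 : ℝ)] with t ht hsq h2 h3 hℓ1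
    set ℓ := Real.log t
    set ℓ₂ := Real.log ℓ
    set ℓ₃ := Real.log ℓ₂
    have hℓ₂0 : 0 < ℓ₂ := by linarith
    have hℓ0 : 0 < ℓ := by linarith
    -- `(1+δ)ℓ₃ ≤ ℓ₂/4`
    have hA : (1 + δ) * ℓ₃ ≤ ℓ₂ / 4 := by
      have := mul_le_mul_of_nonneg_left ht (show 0 ≤ 4 * (1 + δ) by positivity)
      have e : 4 * (1 + δ) * (1 / (4 * (1 + δ)) * ℓ₂) = ℓ₂ := by field_simp
      nlinarith
    -- `ℓ₃ + 3 ≤ ℓ/(4ℓ₂)` from `ℓ₃ ≤ ℓ₂`, `16 ℓ₂² ≤ ℓ`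
    have hℓ₃ℓ₂ : ℓ₃ ≤ ℓ₂ := (Real.log_le_sub_one_of_pos hℓ₂0).trans (by linarith)
    have hB : ℓ₃ + 3 ≤ ℓ / (4 * ℓ₂) := by
      rw [le_div_iff₀ (by positivity)]; nlinarith
    have hfirst : (1 + δ) * ℓ * ℓ₃ / ℓ₂ ^ 2 ≤ ℓ / (4 * ℓ₂) := by
      rw [div_le_div_iff₀ (by positivity) (by positivity)]
      have := mul_le_mul_of_nonneg_left hA hℓ0.le
      nlinarith
    have e : ℓ / (4 * ℓ₂) + ℓ / (4 * ℓ₂) = ℓ / (2 * ℓ₂) := by field_simp; ring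
    linarith
  -- `a8`
  have c9 : ∀ᶠ t : ℝ in atTop, 1 / 4 + 4 / Real.log (Real.log t) + 4 * Real.log (Real.log t) / Real.log t ≤
      Real.log (Real.log t) ^ 2 := by
    filter_upwards [csq (1 / 16) (by norm_num), c1] with t hsq h2
    set ℓ := Real.log t
    set ℓ₂ := Real.log ℓ
    have hℓ₂0 : 0 < ℓ₂ := by linarith
    have hℓ0 : 0 < ℓ := by nlinarith
    have h1 : 4 / ℓ₂ ≤ 4 / 3 := div_le_div_of_nonneg_left (by norm_num) (by norm_num) h2
    have h2' : 4 * ℓ₂ / ℓ ≤ 1 := by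
      rw [div_le_one hℓ0]; nlinarith
    nlinarith
  -- `a9`
  have c10 : ∀ᶠ t : ℝ in atTop, Real.log 96 + Real.log (Real.log t) ≤
      2 * δ * Real.log t * Real.log (Real.log (Real.log t)) / Real.log (Real.log t) := by
    filter_upwards [csq δ hδ0, hL₂.eventually_ge_atTop (Real.log 96), c1, c2] with t hsq h96 h2 h3
    set ℓ := Real.log t
    set ℓ₂ := Real.log ℓ
    set ℓ₃ := Real.log ℓ₂
    have hℓ₂0 : 0 < ℓ₂ := by linarith
    rw [le_div_iff₀ hℓ₂0]
    nlinarith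
  -- `a10`
  have c11 : ∀ᶠ t : ℝ in atTop, 2 * KP * Real.log t ^ 2 ≤ Real.exp (Real.log t / 12) := by
    have h12 : Tendsto (fun t : ℝ ↦ Real.log t / 12) atTop atTop := hL.atTop_div_const (by norm_num)
    have := h12.eventually (eventually_mul_pow_le_exp (2 * KP * 144) 2)
    filter_upwards [this] with t ht
    have e : 2 * KP * 144 * (Real.log t / 12) ^ 2 = 2 * KP * Real.log t ^ 2 := by ring
    linarith
  obtain ⟨t₄, ht₄⟩ := Filter.eventually_atTop.1 (c0.and (c1.and (c2.and (c3.and (c4.and (c5.and (c6.and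
    (c7.and (c8.and (c9.and (c10.and c11)))))))))))
  refine ⟨t₄, fun t ht ↦ ?_⟩
  obtain ⟨a0, a1, a2, a3, a4, a5, a6, a7, a8, a9, a10, a11⟩ := ht₄ t ht
  exact ⟨a0, a1, a2, a3, a4, a5, a6, a7, a8, a9, a10, a11⟩

/-! ### The near-ordinate exponent (Balazard–de Roton 2010, p. 9) -/

/-- Elementary: `log(1 − y) ≥ −2y` for `0 ≤ y ≤ ½`, in the form `log(ℓ − 1) ≥ log ℓ − 2/ℓ` (`ℓ ≥ 2`).
[folklore] -/
lemma log_sub_one_ge {ℓ : ℝ} (hℓ : 2 ≤ ℓ) : Real.log ℓ - 2 / ℓ ≤ Real.log (ℓ - 1) := by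
  have h0 : 0 < ℓ - 1 := by linarith
  have h1 : 1 - (ℓ / (ℓ - 1)) ≤ Real.log ((ℓ - 1) / ℓ) := by
    have := Real.one_sub_inv_le_log_of_pos (div_pos h0 (by linarith))
    rwa [inv_div] at this
  rw [Real.log_div h0.ne' (by linarith)] at h1
  have h2 : ℓ / (ℓ - 1) - 1 ≤ 2 / ℓ := by
    rw [div_sub_one h0.ne', show ℓ - (ℓ - 1) = 1 by ring, div_le_div_iff₀ h0 (by linarith)]
    nlinarith
  linarith

/-- Elementary: `log(ℓ + a) ≤ log ℓ + a/ℓ` for `ℓ > 0`, `a ≥ 0`. [folklore] -/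
lemma log_add_le {ℓ a : ℝ} (hℓ : 0 < ℓ) (ha : 0 ≤ a) : Real.log (ℓ + a) ≤ Real.log ℓ + a / ℓ := by
  have h1 : Real.log ((ℓ + a) / ℓ) ≤ (ℓ + a) / ℓ - 1 := Real.log_le_sub_one_of_pos (by positivity)
  rw [Real.log_div (by linarith) hℓ.ne'] at h1
  have e : (ℓ + a) / ℓ - 1 = a / ℓ := by field_simp; ring
  linarith

/-- **The ladder near `τ`.** If `3t/8 ≤ B ≤ 5t/4` and `V ≤ (½ + L₃B/L₂B) log B/L₂B + 1` (the bound of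
Prop. 18 for the block of `n`, `3τ/4 < n < 5τ/4`), then under `LargeT`
`V ≤ ℓ/(2ℓ₂) + (1+δ)ℓℓ₃/ℓ₂² + ℓ₃ + 3` (`ℓ = log t`, `ℓ₂ = log ℓ`, `ℓ₃ = log ℓ₂`).
[cite: BalazardDeRoton2010, §6.2 (p. 9, bound for `V`)] -/
theorem near_V_le (h : LargeT δ D₂ KP t) (hδ0 : 0 < δ) {B V : ℝ} (hB1 : 3 * t / 8 ≤ B) (hB2 : B ≤ 5 * t / 4)
    (hV : V ≤ (1 / 2 + Real.log (Real.log (Real.log B)) / Real.log (Real.log B)) * Real.log B /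
      Real.log (Real.log B) + 1) :
    V ≤ Real.log t / (2 * Real.log (Real.log t)) +
      (1 + δ) * Real.log t * Real.log (Real.log (Real.log t)) / Real.log (Real.log t) ^ 2 +
      Real.log (Real.log (Real.log t)) + 3 := by
  obtain ⟨ht1, hℓ20, hℓ₂0, hℓ₃0, h4ℓ, hℓ₃ℓ₂⟩ := largeT_sizes h
  set ℓ := Real.log t with hℓ
  set ℓ₂ := Real.log ℓ with hℓ₂
  set ℓ₃ := Real.log ℓ₂ with hℓ₃
  have hl2 : 3 ≤ ℓ₂ := h.l2
  have hl3 : 1 ≤ ℓ₃ := h.l3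
  have ht0 : 0 < t := by linarith
  have hℓ0 : 0 < ℓ := by linarith
  -- `log B ∈ [ℓ − 1, ℓ + 1/4]`
  have hB0 : 0 < B := by linarith
  have hlogB1 : ℓ - 1 ≤ Real.log B := by
    have h1 : Real.log (3 * t / 8) ≤ Real.log B := Real.log_le_log (by positivity) hB1
    rw [show 3 * t / 8 = t * (3 / 8) by ring, Real.log_mul ht0.ne' (by norm_num)] at h1
    have h2 : -1 ≤ Real.log (3 / 8 : ℝ) := by
      rw [show (3 / 8 : ℝ) = (8 / 3)⁻¹ by norm_num, Real.log_inv, neg_le_neg_iff, ← Real.log_exp 1]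
      refine Real.log_le_log (by norm_num) ?_
      have := Real.exp_one_gt_d9; linarith
    linarith
  have hlogB2 : Real.log B ≤ ℓ + 1 / 4 := by
    have h1 : Real.log B ≤ Real.log (5 * t / 4) := Real.log_le_log hB0 hB2
    rw [show 5 * t / 4 = t * (5 / 4) by ring, Real.log_mul ht0.ne' (by norm_num)] at h1
    have h2 : Real.log (5 / 4 : ℝ) ≤ 1 / 4 := by
      have : Real.log (5 / 4 : ℝ) ≤ 5 / 4 - 1 := Real.log_le_sub_one_of_pos (by norm_num)
      linarith
    linarith
  have hlogB0 : 0 < Real.log B := by linarith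
  -- `L₂ B ∈ [ℓ₂ − 2/ℓ, ℓ₂ + 1]`, in particular `L₂B ≥ ℓ₂/2 ≥ 1`
  have hL₂B1 : ℓ₂ - 2 / ℓ ≤ Real.log (Real.log B) := by
    have h1 := log_sub_one_ge (show (2 : ℝ) ≤ ℓ by linarith)
    exact h1.trans (Real.log_le_log (by linarith) hlogB1)
  have hL₂B2 : Real.log (Real.log B) ≤ ℓ₂ + 1 := by
    have h1 : Real.log (Real.log B) ≤ Real.log (ℓ + 1 / 4) := Real.log_le_log hlogB0 hlogB2
    have h2 := log_add_le hℓ0 (show (0 : ℝ) ≤ 1 / 4 by norm_num)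
    have h3 : 1 / 4 / ℓ ≤ 1 := by rw [div_le_one hℓ0]; linarith
    linarith
  have h2ℓ : 2 / ℓ ≤ 1 / 2 := by rw [div_le_iff₀ hℓ0]; linarith
  have hL₂B0 : 1 ≤ Real.log (Real.log B) := by linarith
  have hL₂Bpos : 0 < Real.log (Real.log B) := by linarith
  -- `0 ≤ L₃ B ≤ ℓ₃ + 1/ℓ₂`
  have hL₃B0 : 0 ≤ Real.log (Real.log (Real.log B)) := Real.log_nonneg hL₂B0
  have hL₃B2 : Real.log (Real.log (Real.log B)) ≤ ℓ₃ + 1 / ℓ₂ := by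
    have h1 : Real.log (Real.log (Real.log B)) ≤ Real.log (ℓ₂ + 1) := Real.log_le_log hL₂Bpos hL₂B2
    have h2 := log_add_le hℓ₂0 zero_le_one
    linarith
  -- Term 1: `(log B)/(L₂ B) ≤ ℓ/ℓ₂ + 2`
  have hT1 : Real.log B / Real.log (Real.log B) ≤ ℓ / ℓ₂ + 2 := by
    rw [div_le_iff₀ hL₂Bpos]
    have hden : ℓ₂ - 2 / ℓ ≤ Real.log (Real.log B) := hL₂B1
    -- `ℓ + 1/4 ≤ (ℓ/ℓ₂ + 2)(ℓ₂ − 2/ℓ)` and monotonicity in the second factor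
    have hpos : 0 ≤ ℓ / ℓ₂ + 2 := by positivity
    have h1 : (ℓ / ℓ₂ + 2) * (ℓ₂ - 2 / ℓ) ≤ (ℓ / ℓ₂ + 2) * Real.log (Real.log B) :=
      mul_le_mul_of_nonneg_left hden hpos
    have h2 : (ℓ / ℓ₂ + 2) * (ℓ₂ - 2 / ℓ) = ℓ - 2 / ℓ₂ + 2 * ℓ₂ - 4 / ℓ := by
      field_simp; ring
    have h3 : 2 / ℓ₂ ≤ 1 := by rw [div_le_one hℓ₂0]; linarith
    have h4 : 4 / ℓ ≤ 1 := by rw [div_le_one hℓ0]; linarith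
    linarith
  -- Term 2: `(log B)/(L₂ B)² ≤ ℓ/ℓ₂² + 1`
  have hT2 : Real.log B / Real.log (Real.log B) ^ 2 ≤ ℓ / ℓ₂ ^ 2 + 1 := by
    have hden2 : (ℓ₂ - 2 / ℓ) ^ 2 ≤ Real.log (Real.log B) ^ 2 :=
      pow_le_pow_left₀ (by linarith) hL₂B1 2
    rw [div_le_iff₀ (by positivity)]
    have hpos : 0 ≤ ℓ / ℓ₂ ^ 2 + 1 := by positivity
    have h1 : (ℓ / ℓ₂ ^ 2 + 1) * (ℓ₂ - 2 / ℓ) ^ 2 ≤ (ℓ / ℓ₂ ^ 2 + 1) * Real.log (Real.log B) ^ 2 :=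
      mul_le_mul_of_nonneg_left hden2 hpos
    have h2 : (ℓ / ℓ₂ ^ 2 + 1) * (ℓ₂ - 2 / ℓ) ^ 2 =
        ℓ - 4 / ℓ₂ + 4 / (ℓ * ℓ₂ ^ 2) + ℓ₂ ^ 2 - 4 * ℓ₂ / ℓ + 4 / ℓ ^ 2 := by
      field_simp; ring
    have ha8 := h.a8
    have h3 : 0 ≤ 4 / (ℓ * ℓ₂ ^ 2) := by positivity
    have h5 : 0 ≤ 4 / ℓ ^ 2 := by positivity
    linarith
  -- assemble
  have hρ0 : 0 ≤ Real.log (Real.log (Real.log B)) / Real.log (Real.log B) := by positivity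
  have hmain : (1 / 2 + Real.log (Real.log (Real.log B)) / Real.log (Real.log B)) * Real.log B /
      Real.log (Real.log B) =
      1 / 2 * (Real.log B / Real.log (Real.log B)) +
        Real.log (Real.log (Real.log B)) * (Real.log B / Real.log (Real.log B) ^ 2) := by
    field_simp
  rw [hmain] at hV
  have hA : 1 / 2 * (Real.log B / Real.log (Real.log B)) ≤ ℓ / (2 * ℓ₂) + 1 := by
    have := mul_le_mul_of_nonneg_left hT1 (by norm_num : (0 : ℝ) ≤ 1 / 2)
    have e : 1 / 2 * (ℓ / ℓ₂ + 2) = ℓ / (2 * ℓ₂) + 1 := by field_simp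
    linarith
  have hBterm : Real.log (Real.log (Real.log B)) * (Real.log B / Real.log (Real.log B) ^ 2) ≤
      (ℓ₃ + 1 / ℓ₂) * (ℓ / ℓ₂ ^ 2 + 1) :=
    mul_le_mul hL₃B2 hT2 (by positivity) (by positivity)
  -- `(ℓ₃ + 1/ℓ₂)(ℓ/ℓ₂² + 1) = ℓℓ₃/ℓ₂² + ℓ/ℓ₂³ + ℓ₃ + 1/ℓ₂ ≤ (1+δ)ℓℓ₃/ℓ₂² + ℓ₃ + 1`
  have hexp : (ℓ₃ + 1 / ℓ₂) * (ℓ / ℓ₂ ^ 2 + 1) = ℓ * ℓ₃ / ℓ₂ ^ 2 + ℓ / ℓ₂ ^ 3 + ℓ₃ + 1 / ℓ₂ := by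
    field_simp; ring
  have ha5 := h.a5
  have hsmall : ℓ / ℓ₂ ^ 3 ≤ δ * (ℓ * ℓ₃ / ℓ₂ ^ 2) := by
    -- `1 ≤ δ ℓ₂ ℓ₃`
    rw [div_le_iff₀ (by positivity)]
    have e : δ * (ℓ * ℓ₃ / ℓ₂ ^ 2) * ℓ₂ ^ 3 = (δ * ℓ₂ * ℓ₃) * ℓ := by field_simp
    rw [e]
    nlinarith
  have h1ℓ₂ : 1 / ℓ₂ ≤ 1 := by rw [div_le_one hℓ₂0]; linarith
  have efin : (1 + δ) * ℓ * ℓ₃ / ℓ₂ ^ 2 = ℓ * ℓ₃ / ℓ₂ ^ 2 + δ * (ℓ * ℓ₃ / ℓ₂ ^ 2) := by ring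
  rw [efin]
  linarith

/-- **The `A'`-factor near `τ`**: with `u = log N ≤ ℓ²/(9ℓ₂^{5+12δ})`, `L ≤ u + 1` and
`log B ≥ ℓ − 1`, under `LargeT`: `log(L/log B) ≤ ℓ₂ − (5+12δ)ℓ₃ − log 4` (B–dR: "`log N/log|τ| ≤
log|τ|/(log log|τ|)^5`"). [cite: BalazardDeRoton2010, §6.2 (p. 9)] -/
theorem near_A_le (h : LargeT δ D₂ KP t) (hδ0 : 0 < δ) (hδ1 : δ ≤ 1 / 12) {u L B : ℝ}
    (hu : u ≤ Real.log t ^ 2 / (9 * Real.log (Real.log t) ^ (5 + 12 * δ))) (hL : L ≤ u + 1)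
    (hL0 : 0 < L) (hlogB : Real.log t - 1 ≤ Real.log B) :
    Real.log (L / Real.log B) ≤ Real.log (Real.log t) - (5 + 12 * δ) * Real.log (Real.log (Real.log t)) -
      Real.log 4 := by
  obtain ⟨ht1, hℓ20, hℓ₂0, hℓ₃0, h4ℓ, hℓ₃ℓ₂⟩ := largeT_sizes h
  set ℓ := Real.log t with hℓ
  set ℓ₂ := Real.log ℓ with hℓ₂
  set ℓ₃ := Real.log ℓ₂ with hℓ₃
  have hl2 : 3 ≤ ℓ₂ := h.l2
  have hℓ0 : 0 < ℓ := by linarith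
  set P := ℓ₂ ^ (5 + 12 * δ) with hP
  have hP0 : 0 < P := Real.rpow_pos_of_pos hℓ₂0 _
  have hP1 : 1 ≤ P := Real.one_le_rpow (by linarith) (by linarith)
  -- `P ≤ ℓ₂⁶`, so `72 P ≤ ℓ²`
  have hP6 : P ≤ ℓ₂ ^ 6 := by
    have : ℓ₂ ^ (5 + 12 * δ) ≤ ℓ₂ ^ ((6 : ℕ) : ℝ) :=
      Real.rpow_le_rpow_of_exponent_le (by linarith) (by push_cast; linarith)
    rwa [Real.rpow_natCast] at this
  have h72 : 72 * P ≤ ℓ ^ 2 := le_trans (by nlinarith) h.a4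
  -- `L ≤ ℓ²/(8P)`
  have hL' : L ≤ ℓ ^ 2 / (8 * P) := by
    have h1 : L ≤ ℓ ^ 2 / (9 * P) + 1 := by linarith
    have h2 : ℓ ^ 2 / (9 * P) + 1 ≤ ℓ ^ 2 / (8 * P) := by
      rw [div_add_one (by positivity), div_le_div_iff₀ (by positivity) (by positivity)]
      nlinarith
    linarith
  have hlogB0 : 0 < Real.log B := by linarith
  have hratio : L / Real.log B ≤ ℓ / (4 * P) := by
    rw [div_le_div_iff₀ hlogB0 (by positivity)]
    have h1 : L * (4 * P) ≤ ℓ ^ 2 / (8 * P) * (4 * P) := mul_le_mul_of_nonneg_right hL' (by positivity)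
    have e : ℓ ^ 2 / (8 * P) * (4 * P) = ℓ * (ℓ / 2) := by field_simp; ring
    have h2 : ℓ * (ℓ / 2) ≤ ℓ * Real.log B := mul_le_mul_of_nonneg_left (by linarith) hℓ0.le
    linarith
  calc Real.log (L / Real.log B) ≤ Real.log (ℓ / (4 * P)) := Real.log_le_log (div_pos hL0 hlogB0) hratio
    _ = ℓ₂ - (5 + 12 * δ) * ℓ₃ - Real.log 4 := by
        rw [Real.log_div hℓ0.ne' (by positivity), Real.log_mul (by norm_num) hP0.ne', hP,
          Real.log_rpow hℓ₂0]
        ring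

/-- **The exponent near `τ`** (Balazard–de Roton 2010, p. 9, with Prop. 18's coefficient `1` and the
full power `(log log|τ|)^{5+12δ}`): under `LargeT`, for `16 ≤ V ≤ V_b`, `0 ≤ A' ≤ A_b` as in
`near_V_le`, `near_A_le`, `D₂ ≥ 0`:
`blockExp δ D₂ A' V ≤ ℓ/2 − (½ + 2δ) ℓ ℓ₃/ℓ₂`. [cite: BalazardDeRoton2010, §6.2 (p. 9)] -/
theorem near_exponent_le (h : LargeT δ D₂ KP t) (hδ0 : 0 < δ) (hδ1 : δ ≤ 1 / 12) (hD₂ : 0 ≤ D₂)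
    {A' V : ℝ} (hA0 : 0 ≤ A')
    (hA : A' ≤ Real.log (Real.log t) - (5 + 12 * δ) * Real.log (Real.log (Real.log t)) - Real.log 4)
    (hV16 : 16 ≤ V)
    (hV : V ≤ Real.log t / (2 * Real.log (Real.log t)) +
      (1 + δ) * Real.log t * Real.log (Real.log (Real.log t)) / Real.log (Real.log t) ^ 2 +
      Real.log (Real.log (Real.log t)) + 3) :
    blockExp δ D₂ A' V ≤ Real.log t / 2 -
      (1 / 2 + 2 * δ) * Real.log t * Real.log (Real.log (Real.log t)) / Real.log (Real.log t) := by
  obtain ⟨ht1, hℓ20, hℓ₂0, hℓ₃0, h4ℓ, hℓ₃ℓ₂⟩ := largeT_sizes h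
  set ℓ := Real.log t with hℓ
  set ℓ₂ := Real.log ℓ with hℓ₂
  set ℓ₃ := Real.log ℓ₂ with hℓ₃
  have hl2 : 3 ≤ ℓ₂ := h.l2
  have hl3 : 1 ≤ ℓ₃ := h.l3
  have hℓ0 : 0 < ℓ := by linarith
  set X := ℓ * ℓ₃ / ℓ₂ with hX
  have hX0 : 0 < X := by positivity
  set Vb := ℓ / (2 * ℓ₂) + (1 + δ) * ℓ * ℓ₃ / ℓ₂ ^ 2 + ℓ₃ + 3 with hVb
  set Ab := ℓ₂ - (5 + 12 * δ) * ℓ₃ - Real.log 4 with hAb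
  have hl4 : 0 ≤ Real.log 4 := Real.log_nonneg (by norm_num)
  have hAb0 : 0 ≤ Ab := hA0.trans hA
  have hV0 : 0 ≤ V := by linarith
  -- `Vb ≤ ℓ/ℓ₂` (from `a6`)
  have hVbℓ : Vb ≤ ℓ / ℓ₂ := by
    have ha6 := h.a6
    have e : ℓ / ℓ₂ = ℓ / (2 * ℓ₂) + ℓ / (2 * ℓ₂) := by field_simp; ring
    rw [hVb, e]; linarith
  -- `log log V ≤ ℓ₃` and `≥ 0`
  obtain ⟨hLLV1, hLLV2⟩ := loglog_facts hV16 (hV.trans hVbℓ)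
  have hLLV : Real.log (Real.log V) ≤ ℓ₃ := by
    refine hLLV2.trans ?_
    have h1 : Real.log (ℓ / ℓ₂) ≤ ℓ₂ := by
      rw [Real.log_div hℓ0.ne' hℓ₂0.ne']; linarith
    have h0 : 0 < Real.log (ℓ / ℓ₂) := by
      apply Real.log_pos; rw [lt_div_iff₀ hℓ₂0]; linarith
    exact Real.log_le_log h0 h1
  have hLLV0 : 0 ≤ Real.log (Real.log V) := by linarith
  -- the three terms
  unfold blockExp
  have t1 : V * A' ≤ Vb * Ab := mul_le_mul hV hA hA0 (by linarith)
  have t2 : 2 * (1 + δ) * V * Real.log (Real.log V) ≤ 2 * (1 + δ) * Vb * ℓ₃ := by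
    have : V * Real.log (Real.log V) ≤ Vb * ℓ₃ := mul_le_mul hV hLLV hLLV0 (by linarith)
    have h2 : 0 ≤ 2 * (1 + δ) := by positivity
    calc 2 * (1 + δ) * V * Real.log (Real.log V) = 2 * (1 + δ) * (V * Real.log (Real.log V)) := by ring
      _ ≤ 2 * (1 + δ) * (Vb * ℓ₃) := mul_le_mul_of_nonneg_left this h2
      _ = 2 * (1 + δ) * Vb * ℓ₃ := by ring
  have t3 : D₂ * V * δ⁻¹ ^ 2 ≤ D₂ * δ⁻¹ ^ 2 * (ℓ / ℓ₂) := by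
    have : V ≤ ℓ / ℓ₂ := hV.trans hVbℓ
    have h0 : 0 ≤ D₂ * δ⁻¹ ^ 2 := by positivity
    calc D₂ * V * δ⁻¹ ^ 2 = D₂ * δ⁻¹ ^ 2 * V := by ring
      _ ≤ D₂ * δ⁻¹ ^ 2 * (ℓ / ℓ₂) := mul_le_mul_of_nonneg_left this h0
  -- expand `Vb·Ab` and `Vb ℓ₃` in terms of `X = ℓℓ₃/ℓ₂`
  have eVbAb : Vb * Ab = ℓ / 2 - (3 / 2 + 5 * δ) * X - (1 + δ) * (5 + 12 * δ) * (ℓ * ℓ₃ ^ 2 / ℓ₂ ^ 2)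
      + (ℓ₃ + 3) * (ℓ₂ - (5 + 12 * δ) * ℓ₃) - Real.log 4 * Vb := by
    rw [hVb, hAb, hX]; field_simp; ring
  have eVbℓ₃ : 2 * (1 + δ) * Vb * ℓ₃ = (1 + δ) * X + 2 * (1 + δ) ^ 2 * (ℓ * ℓ₃ ^ 2 / ℓ₂ ^ 2)
      + 2 * (1 + δ) * (ℓ₃ + 3) * ℓ₃ := by
    rw [hVb, hX]; field_simp; ring
  -- the small terms are `≤ 2δ X`
  have hsq : ℓ * ℓ₃ ^ 2 / ℓ₂ ^ 2 = X * (ℓ₃ / ℓ₂) := by rw [hX]; field_simp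
  have hℓ₃ℓ₂' : ℓ₃ / ℓ₂ ≤ δ / 8 := by
    rw [div_le_iff₀ hℓ₂0]; have := h.a1; linarith
  have s1 : 2 * (1 + δ) ^ 2 * (ℓ * ℓ₃ ^ 2 / ℓ₂ ^ 2) ≤ δ / 2 * X := by
    rw [hsq]
    have h1 : 2 * (1 + δ) ^ 2 ≤ 4 := by nlinarith
    have h2 : X * (ℓ₃ / ℓ₂) ≤ X * (δ / 8) := mul_le_mul_of_nonneg_left hℓ₃ℓ₂' hX0.le
    have h3 : 0 ≤ X * (ℓ₃ / ℓ₂) := by positivity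
    calc 2 * (1 + δ) ^ 2 * (X * (ℓ₃ / ℓ₂)) ≤ 4 * (X * (ℓ₃ / ℓ₂)) := mul_le_mul_of_nonneg_right h1 h3
      _ ≤ 4 * (X * (δ / 8)) := by linarith only [h2]
      _ = δ / 2 * X := by ring
  have s2 : D₂ * δ⁻¹ ^ 2 * (ℓ / ℓ₂) ≤ δ / 2 * X := by
    -- `2 D₂ δ⁻³ ≤ ℓ₃`
    have ha2 := h.a2
    have e : δ / 2 * X = (δ / 2 * ℓ₃) * (ℓ / ℓ₂) := by rw [hX]; ring
    rw [e]
    refine mul_le_mul_of_nonneg_right ?_ (by positivity)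
    have hδ3 : δ⁻¹ ^ 2 = δ * δ⁻¹ ^ 3 := by field_simp
    rw [hδ3]
    have h1 := mul_le_mul_of_nonneg_left ha2 (show 0 ≤ δ / 2 by positivity)
    have e2 : δ / 2 * (2 * D₂ * δ⁻¹ ^ 3) = D₂ * (δ * δ⁻¹ ^ 3) := by ring
    linarith only [h1, e2]
  have s3 : (ℓ₃ + 3) * (ℓ₂ - (5 + 12 * δ) * ℓ₃) + 2 * (1 + δ) * (ℓ₃ + 3) * ℓ₃ ≤ δ / 2 * X := by
    -- `≤ (ℓ₃+3)(ℓ₂ + 4ℓ₃) ≤ 5(ℓ₃+3)ℓ₂ ≤ δ X /2` from `a3`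
    have ha3 := h.a3
    have h0 : 0 ≤ ℓ₃ + 3 := by linarith
    have h1 : (ℓ₃ + 3) * (ℓ₂ - (5 + 12 * δ) * ℓ₃) + 2 * (1 + δ) * (ℓ₃ + 3) * ℓ₃ ≤ (ℓ₃ + 3) * (5 * ℓ₂) := by
      have e1 : (ℓ₃ + 3) * (ℓ₂ - (5 + 12 * δ) * ℓ₃) + 2 * (1 + δ) * (ℓ₃ + 3) * ℓ₃ =
          (ℓ₃ + 3) * (ℓ₂ - (3 + 10 * δ) * ℓ₃) := by ring
      rw [e1]
      refine mul_le_mul_of_nonneg_left ?_ h0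
      have : 0 ≤ (3 + 10 * δ) * ℓ₃ := by positivity
      linarith
    have h2 : (ℓ₃ + 3) * (5 * ℓ₂) ≤ δ / 2 * X := by
      have e2 : δ / 2 * X = (δ * ℓ * ℓ₃) / (2 * ℓ₂) := by rw [hX]; field_simp
      rw [e2, le_div_iff₀ (by positivity)]
      have e3 : (ℓ₃ + 3) * (5 * ℓ₂) * (2 * ℓ₂) = 10 * (ℓ₃ + 3) * ℓ₂ ^ 2 := by ring
      rw [e3]; exact ha3
    linarith
  have s4 : 0 ≤ Real.log 4 * Vb := mul_nonneg hl4 (by linarith)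
  have s5 : 0 ≤ (1 + δ) * (5 + 12 * δ) * (ℓ * ℓ₃ ^ 2 / ℓ₂ ^ 2) := by positivity
  -- conclude
  have etarget : ℓ / 2 - (1 / 2 + 2 * δ) * ℓ * ℓ₃ / ℓ₂ = ℓ / 2 - (1 / 2 + 2 * δ) * X := by
    rw [hX]; ring
  rw [etarget]
  have f1 : (3 / 2 + 5 * δ) * X = 3 / 2 * X + 5 * (δ * X) := by ring
  have f2 : (1 + δ) * X = X + δ * X := by ring
  have f3 : δ / 2 * X = 1 / 2 * (δ * X) := by ring
  have f4 : (1 / 2 + 2 * δ) * X = 1 / 2 * X + 2 * (δ * X) := by ring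
  have hδX : 0 ≤ δ * X := by positivity
  linarith only [t1, t2, t3, eVbAb, eVbℓ₃, s1, s2, s3, s4, s5, hδX, f1, f2, f3, f4]

end near

/-! ### The weights `1/(1+|n∓τ|)` and the sum over the near ordinates -/

/-- `1/(1+|n−τ|) + 1/(1+|n+τ|) ≤ 1/(1+n) + 1/(1+|n−|τ| |)` for `n ≥ 0`. [folklore] -/
lemma weight_le_far_add_near {n τ : ℝ} (hn : 0 ≤ n) :
    1 / (1 + |n - τ|) + 1 / (1 + |n + τ|) ≤ 1 / (1 + n) + 1 / (1 + |n - (|τ|)|) := by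
  rcases le_or_gt 0 τ with hτ | hτ
  · rw [abs_of_nonneg hτ]
    have h1 : 1 / (1 + |n + τ|) ≤ 1 / (1 + n) := by
      apply one_div_le_one_div_of_le (by linarith)
      rw [abs_of_nonneg (by linarith)]; linarith
    linarith
  · rw [abs_of_neg hτ, sub_neg_eq_add]
    have h1 : 1 / (1 + |n - τ|) ≤ 1 / (1 + n) := by
      apply one_div_le_one_div_of_le (by linarith)
      rw [abs_of_nonneg (by linarith)]; linarith
    linarith

/-- Far ordinates: `t/4 ≤ |n − t|` (`n ≥ 0`) gives `1/(1+|n−t|) ≤ 5/(1+n)`. [folklore] -/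
lemma weight_far_le {n t : ℝ} (hn : 0 ≤ n) (hfar : t / 4 ≤ |n - t|) :
    1 / (1 + |n - t|) ≤ 5 / (1 + n) := by
  rw [div_le_div_iff₀ (by positivity) (by positivity)]
  have : n ≤ t + |n - t| := by
    have := le_abs_self (n - t); linarith
  nlinarith [abs_nonneg (n - t)]

/-- **The near ordinates contribute `O(log τ)`** ("donc l'intégrale est en `O(log τ)`"): for any
finite set of natural numbers and `t ≥ 8`,
`Σ_{n : |n−t| < t/4} 1/(1+|n−t|) ≤ 2(1 + log(t/4 + 2))`. [cite: BalazardDeRoton2010, §6.2 (p. 9)] -/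
theorem near_harmonic_le (I : Finset ℕ) {t : ℝ} (ht : 8 ≤ t) :
    ∑ n ∈ I.filter (fun n : ℕ ↦ |(n : ℝ) - t| < t / 4), 1 / (1 + |(n : ℝ) - t|) ≤
      2 * (1 + Real.log (t / 4 + 2)) := by
  classical
  set S := I.filter (fun n : ℕ ↦ |(n : ℝ) - t| < t / 4) with hS
  set m := ⌊t⌋₊ with hm
  set J := ⌊t / 4⌋₊ + 2 with hJ
  have ht0 : 0 ≤ t := by linarith
  have hmt : (m : ℝ) ≤ t := Nat.floor_le ht0
  have htm : t < m + 1 := Nat.lt_floor_add_one t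
  have hJt : (J : ℝ) ≤ t / 4 + 2 := by
    rw [hJ]; push_cast; linarith [Nat.floor_le (show 0 ≤ t / 4 by positivity)]
  have hJ1 : (1 : ℝ) ≤ J := by rw [hJ]; push_cast; linarith [(Nat.cast_nonneg ⌊t / 4⌋₊ : (0 : ℝ) ≤ _)]
  have hmem : ∀ n ∈ S, |(n : ℝ) - t| < t / 4 := fun n hn ↦ (Finset.mem_filter.1 hn).2
  -- the harmonic sum over `range J`
  have hharm : ∑ j ∈ Finset.range J, (1 : ℝ) / (1 + j) ≤ 1 + Real.log (t / 4 + 2) := by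
    have h1 : ∑ j ∈ Finset.range J, (1 : ℝ) / (1 + j) = (harmonic J : ℝ) := by
      rw [harmonic]; push_cast
      refine Finset.sum_congr rfl fun j _ ↦ by rw [add_comm]; simp
    rw [h1]
    refine (harmonic_le_one_add_log J).trans ?_
    have := Real.log_le_log (by linarith) hJt
    linarith
  have hgpos : ∀ j : ℕ, (0 : ℝ) ≤ 1 / (1 + j) := fun j ↦ by positivity
  -- split `S` at `m`
  rw [← Finset.sum_filter_add_sum_filter_not S (fun n : ℕ ↦ n ≤ m)]
  -- `n ≤ m`: inject by `n ↦ m − n`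
  have hA : ∑ n ∈ S.filter (fun n : ℕ ↦ n ≤ m), 1 / (1 + |(n : ℝ) - t|) ≤
      ∑ j ∈ Finset.range J, (1 : ℝ) / (1 + j) := by
    set S₁ := S.filter (fun n : ℕ ↦ n ≤ m) with hS₁
    have hle : ∀ n ∈ S₁, 1 / (1 + |(n : ℝ) - t|) ≤ 1 / (1 + ((m - n : ℕ) : ℝ)) := by
      intro n hn
      obtain ⟨hnS, hnm⟩ := Finset.mem_filter.1 hn
      apply one_div_le_one_div_of_le (by positivity)
      rw [Nat.cast_sub hnm]
      have : t - n ≤ |(n : ℝ) - t| := by rw [abs_sub_comm]; exact le_abs_self _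
      linarith
    have hinj : Set.InjOn (fun n : ℕ ↦ m - n) S₁ := by
      intro a ha b hb hab
      have ha' := (Finset.mem_filter.1 ha).2
      have hb' := (Finset.mem_filter.1 hb).2
      simp only at hab; omega
    have hsub : S₁.image (fun n : ℕ ↦ m - n) ⊆ Finset.range J := by
      intro j hj
      rw [Finset.mem_image] at hj
      obtain ⟨n, hn, rfl⟩ := hj
      obtain ⟨hnS, hnm⟩ := Finset.mem_filter.1 hn
      have hnear := hmem n hnS
      rw [Finset.mem_range]
      have h1 : ((m - n : ℕ) : ℝ) < t / 4 := by
        rw [Nat.cast_sub hnm]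
        have := (abs_lt.1 hnear).1
        linarith
      have h2 : ((m - n : ℕ) : ℝ) < J := by
        rw [hJ]; push_cast; linarith [Nat.lt_floor_add_one (t / 4)]
      exact_mod_cast h2
    calc ∑ n ∈ S₁, 1 / (1 + |(n : ℝ) - t|) ≤ ∑ n ∈ S₁, (1 : ℝ) / (1 + ((m - n : ℕ) : ℝ)) :=
          Finset.sum_le_sum hle
      _ = ∑ j ∈ S₁.image (fun n : ℕ ↦ m - n), (1 : ℝ) / (1 + j) := by
          rw [Finset.sum_image hinj]
      _ ≤ ∑ j ∈ Finset.range J, (1 : ℝ) / (1 + j) :=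
          Finset.sum_le_sum_of_subset_of_nonneg hsub fun j _ _ ↦ hgpos j
  -- `m < n`: inject by `n ↦ n − (m+1)`
  have hB : ∑ n ∈ S.filter (fun n : ℕ ↦ ¬n ≤ m), 1 / (1 + |(n : ℝ) - t|) ≤
      ∑ j ∈ Finset.range J, (1 : ℝ) / (1 + j) := by
    set S₂ := S.filter (fun n : ℕ ↦ ¬n ≤ m) with hS₂
    have hle : ∀ n ∈ S₂, 1 / (1 + |(n : ℝ) - t|) ≤ 1 / (1 + ((n - (m + 1) : ℕ) : ℝ)) := by
      intro n hn
      obtain ⟨hnS, hnm⟩ := Finset.mem_filter.1 hn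
      push Not at hnm
      apply one_div_le_one_div_of_le (by positivity)
      rw [Nat.cast_sub (by omega)]
      push_cast
      have : (n : ℝ) - t ≤ |(n : ℝ) - t| := le_abs_self _
      linarith
    have hinj : Set.InjOn (fun n : ℕ ↦ n - (m + 1)) S₂ := by
      intro a ha b hb hab
      have ha' := (Finset.mem_filter.1 ha).2
      have hb' := (Finset.mem_filter.1 hb).2
      simp only at hab; omega
    have hsub : S₂.image (fun n : ℕ ↦ n - (m + 1)) ⊆ Finset.range J := by
      intro j hj
      rw [Finset.mem_image] at hj
      obtain ⟨n, hn, rfl⟩ := hj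
      obtain ⟨hnS, hnm⟩ := Finset.mem_filter.1 hn
      push Not at hnm
      have hnear := hmem n hnS
      rw [Finset.mem_range]
      have h1 : ((n - (m + 1) : ℕ) : ℝ) < t / 4 := by
        rw [Nat.cast_sub (by omega)]
        push_cast
        have := (abs_lt.1 hnear).2
        linarith
      have h2 : ((n - (m + 1) : ℕ) : ℝ) < J := by
        rw [hJ]; push_cast; linarith [Nat.lt_floor_add_one (t / 4)]
      exact_mod_cast h2
    calc ∑ n ∈ S₂, 1 / (1 + |(n : ℝ) - t|) ≤ ∑ n ∈ S₂, (1 : ℝ) / (1 + ((n - (m + 1) : ℕ) : ℝ)) :=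
          Finset.sum_le_sum hle
      _ = ∑ j ∈ S₂.image (fun n : ℕ ↦ n - (m + 1)), (1 : ℝ) / (1 + j) := by
          rw [Finset.sum_image hinj]
      _ ≤ ∑ j ∈ Finset.range J, (1 : ℝ) / (1 + j) :=
          Finset.sum_le_sum_of_subset_of_nonneg hsub fun j _ _ ↦ hgpos j
  linarith

/-! ### The near blocks: `e^{E_n} ≤ exp(ℓ/2 − (½+2δ)ℓℓ₃/ℓ₂)` -/

section assembly

variable {δ D C D₂₀ Ca tthr : ℝ} {M N : ℕ} {T₁ T₁₈ T₂₀ KP : ℝ}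

/-- `u = log N ≤ ℓ²/(9 ℓ₂^{5+12δ})` from `3Λ(N) ≤ ℓ ≤ ¾ u` (`Λ = u^{1/2}v^{5/2+6δ}`, `v = log u ≥ ℓ₂`).
[cite: BalazardDeRoton2010, §6.2 (p. 9, "`log N/log|τ| ≤ log|τ|/(log log|τ|)^5`")] -/
lemma log_N_le_of_range (hδ0 : 0 < δ) {u ℓ : ℝ} (hu1 : 1 < u) (hℓ1 : 1 < ℓ)
    (hΛ : 3 * (u ^ (1 / 2 : ℝ) * Real.log u ^ (5 / 2 + 6 * δ)) ≤ ℓ) (hℓu : ℓ ≤ 3 / 4 * u) :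
    u ≤ ℓ ^ 2 / (9 * Real.log ℓ ^ (5 + 12 * δ)) := by
  have hu0 : 0 < u := by linarith
  have hv0 : 0 < Real.log u := Real.log_pos hu1
  have hℓ₂0 : 0 < Real.log ℓ := Real.log_pos hℓ1
  have hvℓ : Real.log ℓ ≤ Real.log u := Real.log_le_log (by linarith) (by linarith)
  -- square the hypothesis
  have hsq : 9 * (u * Real.log u ^ (5 + 12 * δ)) ≤ ℓ ^ 2 := by
    have h0 : 0 ≤ 3 * (u ^ (1 / 2 : ℝ) * Real.log u ^ (5 / 2 + 6 * δ)) := by positivity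
    have h1 := pow_le_pow_left₀ h0 hΛ 2
    have e : (3 * (u ^ (1 / 2 : ℝ) * Real.log u ^ (5 / 2 + 6 * δ))) ^ 2 = 9 * (u * Real.log u ^ (5 + 12 * δ)) := by
      rw [mul_pow, mul_pow, ← Real.rpow_natCast (u ^ (1 / 2 : ℝ)) 2, ← Real.rpow_mul hu0.le,
        ← Real.rpow_natCast (Real.log u ^ (5 / 2 + 6 * δ)) 2, ← Real.rpow_mul hv0.le]
      norm_num; left; ring_nf
    rwa [e] at h1
  have hP : Real.log ℓ ^ (5 + 12 * δ) ≤ Real.log u ^ (5 + 12 * δ) :=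
    Real.rpow_le_rpow hℓ₂0.le hvℓ (by linarith)
  have hPℓ : 0 < Real.log ℓ ^ (5 + 12 * δ) := Real.rpow_pos_of_pos hℓ₂0 _
  rw [le_div_iff₀ (by positivity)]
  calc u * (9 * Real.log ℓ ^ (5 + 12 * δ)) ≤ u * (9 * Real.log u ^ (5 + 12 * δ)) :=
        mul_le_mul_of_nonneg_left (by linarith) hu0.le
    _ = 9 * (u * Real.log u ^ (5 + 12 * δ)) := by ring
    _ ≤ ℓ ^ 2 := hsq

/-- **Pointwise bound on a near block** (Balazard–de Roton 2010, p. 9): for `N₀ ≤ n < T` with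
`|n − t| < t/4` (`t = |τ|` in the range of Prop. 12, `t` large), `E_n ≤ ℓ/2 − (½+2δ)ℓℓ₃/ℓ₂`.
[cite: BalazardDeRoton2010, §6.2 (p. 9)] -/
theorem near_blockE_le (hδ0 : 0 < δ) (hδ1 : δ ≤ 1 / 12) (hD : 0 ≤ D) (h18 : Prop18With δ T₁₈)
    (h : LargeN δ D C D₂₀ Ca M tthr N)
    (hthr : ∀ t : ℝ, tthr ≤ t → GoodSize T₁ T₁₈ t ∧ GoodCount δ D₂₀ T₂₀ t)
    {t : ℝ} (hT : LargeT δ (D + 2) KP t)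
    (hΛ : 3 * lam (5 / 2 + 6 * δ) N ≤ Real.log t) (htN : Real.log t ≤ 3 / 4 * Real.log N)
    {n : ℕ} (h1 : nzero N ≤ n) (h2 : n < bigT N) (hnear : |(n : ℝ) - t| < t / 4) :
    blockE δ (max D 0 + 2) (Real.log ((N : ℝ) + 1 / 2)) n ≤
      Real.log t / 2 - (1 / 2 + 2 * δ) * Real.log t * Real.log (Real.log (Real.log t)) / Real.log (Real.log t) := by
  obtain ⟨hu22, hκ1, hκK, hκy, hyκ, hKu, hKl, hTN, hNT, hN0⟩ := params h
  obtain ⟨ht1, hℓ16, hℓ₂0, hℓ₃0, h4ℓ, hℓ₃ℓ₂⟩ := largeT_sizes hT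
  have hmax : max D 0 = D := max_eq_left hD
  have ht0 : 0 < t := by linarith
  -- block data
  have hTx : ((bigT N : ℕ) : ℝ) ≤ (N : ℝ) + 1 / 2 := by
    have : ((bigT N : ℕ) : ℝ) ≤ N := by exact_mod_cast hTN
    linarith
  have hN₀thr : tthr ≤ ((nzero N : ℕ) : ℝ) := thr_le_two_pow h le_rfl
  have hgood : ∀ s : ℝ, ((nzero N : ℕ) : ℝ) ≤ s → s ≤ (N : ℝ) + 1 / 2 → GoodSize T₁ T₁₈ s :=
    fun s hs _ ↦ (hthr s (hN₀thr.trans hs)).1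
  obtain ⟨⟨hNb, hb1, hb2, hbT⟩, hg, hadm, h4, hup, hlog, hlogx, hbn, hnT⟩ :=
    block_data (δ := δ) h18 (rfl : nzero N = 2 ^ kap N) (rfl : bigT N = 2 ^ bigK N) hTx hgood h1 h2
  obtain ⟨-, -, -, -, hvs⟩ := lad_facts h18 hg hb1 hb2
  set B : ℝ := (bbase n : ℝ) with hBdef
  set V : ℝ := (lad δ n : ℝ) with hV
  have hBthr : tthr ≤ B := le_trans hN₀thr (by rw [hBdef]; exact_mod_cast hNb)
  obtain ⟨-, hgc⟩ := hthr B hBthr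
  have hL₂B4 : 4 ≤ Real.log (Real.log B) := hgc.2.1
  have hV16 : 16 ≤ V := by
    have : (4 : ℝ) ^ 2 ≤ Real.log (Real.log B) ^ 2 := pow_le_pow_left₀ (by norm_num) hL₂B4 2
    have h2 := hadm.1; rw [← hV] at h2; linarith
  -- `3t/8 ≤ B ≤ 5t/4`
  have hn34 : 3 * t / 4 < n := by have := (abs_lt.1 hnear).1; linarith
  have hn54 : (n : ℝ) < 5 * t / 4 := by have := (abs_lt.1 hnear).2; linarith
  have hB1 : 3 * t / 8 ≤ B := by
    have : (n : ℝ) + 1 ≤ 2 * B := by rw [hBdef]; exact_mod_cast hb2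
    linarith
  have hB2 : B ≤ 5 * t / 4 := by linarith
  -- the bounds on `V` and `A'`
  have hVb := near_V_le hT hδ0 hB1 hB2 hvs
  set u := Real.log N with hu
  set L := Real.log ((N : ℝ) + 1 / 2) with hL
  obtain ⟨hLu, hLu1⟩ := log_x_bounds (N := N) (by
    have : Real.log (N : ℝ) ≤ (N : ℝ) - 1 := Real.log_le_sub_one_of_pos hN0
    linarith)
  have hu_le : u ≤ Real.log t ^ 2 / (9 * Real.log (Real.log t) ^ (5 + 12 * δ)) := by
    have hΛ' : 3 * (u ^ (1 / 2 : ℝ) * Real.log u ^ (5 / 2 + 6 * δ)) ≤ Real.log t := by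
      unfold lam at hΛ; exact hΛ
    exact log_N_le_of_range hδ0 (show (1 : ℝ) < u by linarith) (show (1 : ℝ) < Real.log t by linarith)
      hΛ' htN
  have hlogB1 : Real.log t - 1 ≤ Real.log B := by
    have hB0 : 0 < B := by linarith
    have h1 : Real.log (3 * t / 8) ≤ Real.log B := Real.log_le_log (by positivity) hB1
    rw [show 3 * t / 8 = t * (3 / 8) by ring, Real.log_mul ht0.ne' (by norm_num)] at h1
    have h2 : -1 ≤ Real.log (3 / 8 : ℝ) := by
      rw [show (3 / 8 : ℝ) = (8 / 3)⁻¹ by norm_num, Real.log_inv, neg_le_neg_iff, ← Real.log_exp 1]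
      refine Real.log_le_log (by norm_num) ?_
      have := Real.exp_one_gt_d9; linarith
    linarith
  have hL0 : 0 < L := by rw [hL]; linarith
  have hAb := near_A_le hT hδ0 hδ1 hu_le (by rw [hL]; linarith) hL0 hlogB1
  have hlogB0 : 0 < Real.log B := by linarith
  have hA0 : 0 ≤ Real.log (L / Real.log B) :=
    Real.log_nonneg ((one_le_div hlogB0).2 (by rw [hL]; exact hlogx))
  have hE := near_exponent_le hT hδ0 hδ1 (by linarith : (0 : ℝ) ≤ D + 2) hA0 hAb hV16 hVb
  have e : blockE δ (max D 0 + 2) L n = blockExp δ (D + 2) (Real.log (L / Real.log B)) V := by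
    rw [show blockE δ (max D 0 + 2) L n = blockExp δ (max D 0 + 2) (Real.log (L / Real.log B)) V from rfl, hmax]
  rw [e]; exact hE

/-- **The twisted block sum `S(τ)`**: far part by (t46) (`far_sum_le`), near part by the pointwise
bound and the harmonic sum: `S(τ) ≤ 6 e^{Λ} + e^{E_b}·2(1 + log(t/4+2))`.
[cite: BalazardDeRoton2010, §6.2 (pp. 8–9)] -/
theorem twisted_sum_le (hδ0 : 0 < δ) (hδ1 : δ ≤ 1 / 12) (hD : 0 ≤ D) (h18 : Prop18With δ T₁₈)
    (h20 : Prop20With δ C D₂₀ T₂₀) (hC : 0 ≤ C) (h : LargeN δ D C D₂₀ Ca M tthr N)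
    (hthr : ∀ t : ℝ, tthr ≤ t → GoodSize T₁ T₁₈ t ∧ GoodCount δ D₂₀ T₂₀ t)
    {τ : ℝ} (hT : LargeT δ (D + 2) KP |τ|)
    (hΛ : 3 * lam (5 / 2 + 6 * δ) N ≤ Real.log |τ|) (htN : Real.log |τ| ≤ 3 / 4 * Real.log N) :
    ∑ n ∈ Finset.Ico (nzero N) (bigT N),
        Real.exp (blockE δ (max D 0 + 2) (Real.log ((N : ℝ) + 1 / 2)) n) *
          (1 / (1 + |(n : ℝ) - τ|) + 1 / (1 + |(n : ℝ) + τ|)) ≤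
      6 * Real.exp (lam (5 / 2 + 6 * δ) N) +
        Real.exp (Real.log |τ| / 2 - (1 / 2 + 2 * δ) * Real.log |τ| * Real.log (Real.log (Real.log |τ|)) /
          Real.log (Real.log |τ|)) * (2 * (1 + Real.log (|τ| / 4 + 2))) := by
  classical
  set t := |τ| with ht
  set I := Finset.Ico (nzero N) (bigT N) with hI
  set e : ℕ → ℝ := fun n ↦ Real.exp (blockE δ (max D 0 + 2) (Real.log ((N : ℝ) + 1 / 2)) n) with he
  set Eb := Real.log t / 2 - (1 / 2 + 2 * δ) * Real.log t * Real.log (Real.log (Real.log t)) /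
    Real.log (Real.log t) with hEb
  have ht8 : 8 ≤ t := hT.t8
  have ht0 : 0 ≤ t := by linarith
  have he0 : ∀ n, 0 ≤ e n := fun n ↦ (Real.exp_pos _).le
  have hfar := far_sum_le hδ0 (by linarith) hD h18 h20 hC h hthr
  -- step 1: the weights
  have h1 : ∑ n ∈ I, e n * (1 / (1 + |(n : ℝ) - τ|) + 1 / (1 + |(n : ℝ) + τ|)) ≤
      ∑ n ∈ I, e n * (1 / (1 + (n : ℝ))) + ∑ n ∈ I, e n * (1 / (1 + |(n : ℝ) - t|)) := by
    rw [← Finset.sum_add_distrib]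
    refine Finset.sum_le_sum fun n _ ↦ ?_
    rw [← mul_add]
    exact mul_le_mul_of_nonneg_left (weight_le_far_add_near (Nat.cast_nonneg n)) (he0 n)
  -- step 2: the far sum
  have h2 : ∑ n ∈ I, e n * (1 / (1 + (n : ℝ))) ≤ Real.exp (lam (5 / 2 + 6 * δ) N) := by
    refine le_trans (le_of_eq (Finset.sum_congr rfl fun n _ ↦ ?_)) hfar
    rw [he]; simp only; rw [add_comm (1 : ℝ) n]; ring
  -- step 3: split the second sum
  have h3 : ∑ n ∈ I, e n * (1 / (1 + |(n : ℝ) - t|)) ≤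
      5 * Real.exp (lam (5 / 2 + 6 * δ) N) + Real.exp Eb * (2 * (1 + Real.log (t / 4 + 2))) := by
    rw [← Finset.sum_filter_add_sum_filter_not I (fun n : ℕ ↦ |(n : ℝ) - t| < t / 4)]
    -- near
    have hnear : ∑ n ∈ I.filter (fun n : ℕ ↦ |(n : ℝ) - t| < t / 4), e n * (1 / (1 + |(n : ℝ) - t|)) ≤
        Real.exp Eb * (2 * (1 + Real.log (t / 4 + 2))) := by
      have hpt : ∀ n ∈ I.filter (fun n : ℕ ↦ |(n : ℝ) - t| < t / 4),
          e n * (1 / (1 + |(n : ℝ) - t|)) ≤ Real.exp Eb * (1 / (1 + |(n : ℝ) - t|)) := by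
        intro n hn
        obtain ⟨hnI, hnn⟩ := Finset.mem_filter.1 hn
        rw [hI, Finset.mem_Ico] at hnI
        refine mul_le_mul_of_nonneg_right ?_ (by positivity)
        exact Real.exp_le_exp.2 (near_blockE_le hδ0 hδ1 hD h18 h hthr hT hΛ htN hnI.1 hnI.2 hnn)
      refine (Finset.sum_le_sum hpt).trans ?_
      rw [← Finset.mul_sum]
      exact mul_le_mul_of_nonneg_left (near_harmonic_le I ht8) (Real.exp_pos _).le
    -- far
    have hfar' : ∑ n ∈ I.filter (fun n : ℕ ↦ ¬|(n : ℝ) - t| < t / 4), e n * (1 / (1 + |(n : ℝ) - t|)) ≤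
        5 * Real.exp (lam (5 / 2 + 6 * δ) N) := by
      calc ∑ n ∈ I.filter (fun n : ℕ ↦ ¬|(n : ℝ) - t| < t / 4), e n * (1 / (1 + |(n : ℝ) - t|))
          ≤ ∑ n ∈ I.filter (fun n : ℕ ↦ ¬|(n : ℝ) - t| < t / 4), e n * (5 / (1 + (n : ℝ))) := by
            refine Finset.sum_le_sum fun n hn ↦ ?_
            obtain ⟨-, hnn⟩ := Finset.mem_filter.1 hn
            push Not at hnn
            exact mul_le_mul_of_nonneg_left (weight_far_le (Nat.cast_nonneg n) hnn) (he0 n)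
        _ ≤ ∑ n ∈ I, e n * (5 / (1 + (n : ℝ))) :=
            Finset.sum_le_sum_of_subset_of_nonneg (Finset.filter_subset _ _) fun n _ _ ↦ by positivity
        _ = 5 * ∑ n ∈ I, e n * (1 / (1 + (n : ℝ))) := by
            rw [Finset.mul_sum]; refine Finset.sum_congr rfl fun n _ ↦ by ring
        _ ≤ 5 * Real.exp (lam (5 / 2 + 6 * δ) N) := by linarith
    linarith
  linarith

/-! ### Proposition 12 from the engine -/

/-- `(N:ℝ)^{3/4} ≤ N/8` for `N ≥ 4096`. [folklore] -/
lemma rpow_three_quarters_le {N : ℝ} (hN : 4096 ≤ N) : N ^ (3 / 4 : ℝ) ≤ N / 8 := by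
  have hN0 : 0 < N := by linarith
  have h8 : (8 : ℝ) ≤ N ^ (1 / 4 : ℝ) := by
    have h1 : (4096 : ℝ) ^ (1 / 4 : ℝ) ≤ N ^ (1 / 4 : ℝ) := Real.rpow_le_rpow (by norm_num) hN (by norm_num)
    have h2 : (4096 : ℝ) ^ (1 / 4 : ℝ) = 8 := by
      rw [show (4096 : ℝ) = 8 ^ (4 : ℝ) by norm_num, ← Real.rpow_mul (by norm_num)]; norm_num
    linarith
  have hsplit : N = N ^ (3 / 4 : ℝ) * N ^ (1 / 4 : ℝ) := by
    rw [← Real.rpow_add hN0]; norm_num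
  rw [le_div_iff₀ (by norm_num)]
  calc N ^ (3 / 4 : ℝ) * 8 ≤ N ^ (3 / 4 : ℝ) * N ^ (1 / 4 : ℝ) :=
        mul_le_mul_of_nonneg_left h8 (Real.rpow_nonneg hN0.le _)
    _ = N := hsplit.symm

/-- `Λ_p(N) → ∞`. [folklore] -/
lemma tendsto_lam {p : ℝ} (hp : 0 < p) : Tendsto (lam p) atTop atTop := by
  have h1 : Tendsto (fun N : ℕ ↦ Real.log N ^ (1 / 2 : ℝ)) atTop atTop :=
    (tendsto_rpow_atTop (by norm_num)).comp tendsto_log_nat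
  have h2 : Tendsto (fun N : ℕ ↦ Real.log (Real.log N) ^ p) atTop atTop :=
    (tendsto_rpow_atTop hp).comp (Real.tendsto_log_atTop.comp tendsto_log_nat)
  exact h1.atTop_mul_atTop₀ h2

/-- Numeric comparison for Prop. 12: with `P = t^{1/2−κ(t)} = exp((½ − ℓ₃/(2ℓ₂))ℓ)`, under `LargeT`
and `Λ ≤ ℓ/3`: `48 e^{E_b}(1 + log(t/4+2)) ≤ P`, `e^Λ ≤ P`, `1 ≤ P`. [cite: BalazardDeRoton2010, §6.2 (p. 9, conclusion)] -/
lemma prop12_numerics {t : ℝ} (hT : LargeT δ (D + 2) KP t) (hδ0 : 0 < δ) (hδ1 : δ ≤ 1 / 12) {Λ : ℝ}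
    (hΛ : 3 * Λ ≤ Real.log t) :
    48 * Real.exp (Real.log t / 2 - (1 / 2 + 2 * δ) * Real.log t * Real.log (Real.log (Real.log t)) /
        Real.log (Real.log t)) * (1 + Real.log (t / 4 + 2)) ≤
        Real.exp ((1 / 2 - Real.log (Real.log (Real.log t)) / (2 * Real.log (Real.log t))) * Real.log t) ∧
      Real.exp Λ ≤ Real.exp ((1 / 2 - Real.log (Real.log (Real.log t)) / (2 * Real.log (Real.log t))) * Real.log t) ∧
      1 ≤ Real.exp ((1 / 2 - Real.log (Real.log (Real.log t)) / (2 * Real.log (Real.log t))) * Real.log t) ∧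
      Real.log (Real.log (Real.log t)) / (2 * Real.log (Real.log t)) ≤ 1 / 24 := by
  obtain ⟨ht1, hℓ16, hℓ₂0, hℓ₃0, h4ℓ, hℓ₃ℓ₂⟩ := largeT_sizes hT
  set ℓ := Real.log t with hℓ
  set ℓ₂ := Real.log ℓ with hℓ₂
  set ℓ₃ := Real.log ℓ₂ with hℓ₃
  have ht0 : 0 < t := by linarith
  have hℓ0 : 0 < ℓ := by linarith
  have ha1 := hT.a1
  have hκ : ℓ₃ / (2 * ℓ₂) ≤ 1 / 24 := by
    rw [div_le_div_iff₀ (by positivity) (by norm_num)]; nlinarith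
  set X := ℓ * ℓ₃ / ℓ₂ with hX
  have hX0 : 0 ≤ X := by positivity
  have eP : (1 / 2 - ℓ₃ / (2 * ℓ₂)) * ℓ = ℓ / 2 - X / 2 := by rw [hX]; field_simp
  refine ⟨?_, ?_, ?_, hκ⟩
  · -- `48 e^{Eb}(1+log(t/4+2)) ≤ 96 ℓ e^{Eb} = exp(log 96 + ℓ₂ + Eb) ≤ P`
    have hlog : 1 + Real.log (t / 4 + 2) ≤ 2 * ℓ := by
      have h1 : Real.log (t / 4 + 2) ≤ ℓ := by
        rw [hℓ]; exact Real.log_le_log (by positivity) (by linarith [hT.t8])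
      linarith
    have he0 : 0 < Real.exp (ℓ / 2 - (1 / 2 + 2 * δ) * ℓ * ℓ₃ / ℓ₂) := Real.exp_pos _
    have h96 : (96 : ℝ) * ℓ = Real.exp (Real.log 96 + ℓ₂) := by
      rw [Real.exp_add, Real.exp_log (by norm_num), hℓ₂, Real.exp_log hℓ0]
    have ha9 := hT.a9
    calc 48 * Real.exp (ℓ / 2 - (1 / 2 + 2 * δ) * ℓ * ℓ₃ / ℓ₂) * (1 + Real.log (t / 4 + 2))
        ≤ 48 * Real.exp (ℓ / 2 - (1 / 2 + 2 * δ) * ℓ * ℓ₃ / ℓ₂) * (2 * ℓ) :=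
          mul_le_mul_of_nonneg_left hlog (by positivity)
      _ = (96 * ℓ) * Real.exp (ℓ / 2 - (1 / 2 + 2 * δ) * ℓ * ℓ₃ / ℓ₂) := by ring
      _ = Real.exp (Real.log 96 + ℓ₂ + (ℓ / 2 - (1 / 2 + 2 * δ) * ℓ * ℓ₃ / ℓ₂)) := by
          rw [h96, ← Real.exp_add]
      _ ≤ Real.exp ((1 / 2 - ℓ₃ / (2 * ℓ₂)) * ℓ) := by
          refine Real.exp_le_exp.2 ?_
          rw [eP]
          have e1 : (1 / 2 + 2 * δ) * ℓ * ℓ₃ / ℓ₂ = X / 2 + 2 * δ * X := by rw [hX]; ring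
          have e2 : 2 * δ * Real.log t * Real.log (Real.log (Real.log t)) / Real.log (Real.log t) = 2 * δ * X := by
            rw [hX]; ring
          rw [e2] at ha9
          linarith
  · refine Real.exp_le_exp.2 ?_
    rw [eP]
    have : X / 2 ≤ ℓ / 24 := by
      rw [hX]
      have := mul_le_mul_of_nonneg_left hκ hℓ0.le
      have e : ℓ * (ℓ₃ / (2 * ℓ₂)) = ℓ * ℓ₃ / ℓ₂ / 2 := by ring
      linarith
    linarith
  · apply Real.one_le_exp
    rw [eP]
    have : X / 2 ≤ ℓ / 24 := by
      have := mul_le_mul_of_nonneg_left hκ hℓ0.le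
      have e : ℓ * (ℓ₃ / (2 * ℓ₂)) = X / 2 := by rw [hX]; ring
      linarith
    linarith

/-- `‖(2π)⁻¹ x^{−iτ} B‖ ≤ ‖B‖/6` (`x > 0`). [folklore] -/
lemma norm_perron_prefactor_le {x τ : ℝ} (hx : 0 < x) (B : ℂ) :
    ‖(2 * π : ℂ)⁻¹ * (x : ℂ) ^ (-((τ : ℂ) * I)) * B‖ ≤ ‖B‖ / 6 := by
  rw [norm_mul, norm_mul, Complex.norm_cpow_eq_rpow_re_of_pos hx]
  have hre : (-((τ : ℂ) * I)).re = 0 := by simp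
  rw [hre, Real.rpow_zero, mul_one, norm_inv, Complex.norm_mul, Complex.norm_ofNat, Complex.norm_real,
    Real.norm_eq_abs, abs_of_pos Real.pi_pos, div_eq_inv_mul]
  refine mul_le_mul_of_nonneg_right ?_ (norm_nonneg _)
  exact inv_anti₀ (by norm_num) (by linarith [Real.pi_gt_three])

/-- Bookkeeping for `‖B‖`: `‖B‖ ≤ √x(24S + e^Λ) + √x`, `24S + e^Λ ≤ 146P`, `1 ≤ P`, `√x ≤ 2√N` give
`‖B‖ ≤ 294 √N P`. [folklore] -/
lemma normB_numerics {b sx sN S E P : ℝ} (hsx0 : 0 ≤ sx) (hsx : sx ≤ 2 * sN) (hP1 : 1 ≤ P)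
    (hb : b ≤ sx * (24 * S + E) + sx) (hSE : 24 * S + E ≤ 146 * P) : b ≤ 294 * sN * P := by
  have h1 : sx * (24 * S + E) ≤ sx * (146 * P) := mul_le_mul_of_nonneg_left hSE hsx0
  have h2 : sx ≤ sx * P := le_mul_of_one_le_right hsx0 hP1
  have h3 : sx * P ≤ 2 * sN * P := mul_le_mul_of_nonneg_right hsx (by linarith)
  nlinarith

/-- **The Perron error is negligible**: under `LargeT` and the range of Prop. 12,
`KP(1+t)L ≤ e^{u/2}·t^{1/2−κ(t)}` (`u = log N`, `L = log x ≤ u + 1`; B–dR: "`|τ| log N ≤ N^{1/2}|τ|^{2/5}`").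
[cite: BalazardDeRoton2010, §6.2 (p. 9, conclusion)] -/
lemma perron_err_numerics {t : ℝ} (hT : LargeT δ (D + 2) KP t) (hδ0 : 0 < δ) (hδ1 : δ ≤ 1 / 12)
    (hKP : 0 < KP) {u L : ℝ} (hu22 : 22 ≤ u)
    (hΛ' : 3 * (u ^ (1 / 2 : ℝ) * Real.log u ^ (5 / 2 + 6 * δ)) ≤ Real.log t)
    (hℓu : Real.log t ≤ 3 / 4 * u) (hL : L ≤ u + 1) (hL0 : 0 ≤ L) :
    KP * (1 + t) * L ≤ Real.exp (u / 2) *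
      Real.exp ((1 / 2 - Real.log (Real.log (Real.log t)) / (2 * Real.log (Real.log t))) * Real.log t) := by
  obtain ⟨ht1, hℓ16, hℓ₂0, hℓ₃0, h4ℓ, hℓ₃ℓ₂⟩ := largeT_sizes hT
  obtain ⟨-, -, -, hκ24⟩ := prop12_numerics hT hδ0 hδ1 (Λ := 0) (by linarith)
  set ℓ := Real.log t with hℓ
  have ht0 : 0 < t := by linarith
  have hu_le := log_N_le_of_range hδ0 (show (1 : ℝ) < u by linarith) (show (1 : ℝ) < ℓ by linarith)
    hΛ' hℓu
  have hP1 : 1 ≤ Real.log ℓ ^ (5 + 12 * δ) := Real.one_le_rpow (by linarith [hT.l2]) (by linarith)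
  have huℓ : u ≤ ℓ ^ 2 / 9 := by
    refine hu_le.trans ?_
    rw [div_le_div_iff₀ (by positivity) (by norm_num)]
    exact mul_le_mul_of_nonneg_left (by linarith) (sq_nonneg ℓ)
  have hLℓ : L ≤ ℓ ^ 2 := by
    have h2 : (16 : ℝ) ^ 2 ≤ ℓ ^ 2 := pow_le_pow_left₀ (by norm_num) hℓ16 2
    linarith
  have h1t : 1 + t ≤ 2 * t := by linarith
  have ha10 := hT.a10
  have hstep : KP * (1 + t) * L ≤ Real.exp (13 * ℓ / 12) := by
    calc KP * (1 + t) * L ≤ KP * (2 * t) * ℓ ^ 2 :=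
          mul_le_mul (mul_le_mul_of_nonneg_left h1t hKP.le) hLℓ hL0 (by positivity)
      _ = t * (2 * KP * ℓ ^ 2) := by ring
      _ ≤ t * Real.exp (ℓ / 12) := mul_le_mul_of_nonneg_left ha10 ht0.le
      _ = Real.exp ℓ * Real.exp (ℓ / 12) := by rw [hℓ, Real.exp_log ht0]
      _ = Real.exp (13 * ℓ / 12) := by rw [← Real.exp_add]; congr 1; ring
  refine hstep.trans ?_
  rw [← Real.exp_add]
  refine Real.exp_le_exp.2 ?_
  have h1 : 2 / 3 * ℓ ≤ u / 2 := by linarith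
  have hℓ0 : 0 ≤ ℓ := by linarith
  have h2 : (11 / 24) * ℓ ≤ (1 / 2 - Real.log (Real.log ℓ) / (2 * Real.log ℓ)) * ℓ := by
    have := mul_le_mul_of_nonneg_right hκ24 hℓ0
    nlinarith
  linarith

/-- **`M_N(iτ) ≤ 50 √N |τ|^{1/2−κ(τ)}` in the range of Prop. 12, for `N` large**, from the engine at
level `δ ∈ (0, 1/12]`. [cite: BalazardDeRoton2010, Prop. 12] -/
theorem exists_twist_nat_le (hRH : RiemannHypothesis) {δ : ℝ} (hδ0 : 0 < δ) (hδ1 : δ ≤ 1 / 12)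
    (h1 : ∃ D T₀ : ℝ, Prop1With δ D T₀) (h18 : ∃ T₀ : ℝ, Prop18With δ T₀)
    (h20 : ∃ C D T₀ : ℝ, Prop20With δ C D T₀) :
    ∃ N₁ : ℕ, ∀ N : ℕ, N₁ ≤ N → ∀ τ : ℝ, Real.exp (3 * lam (5 / 2 + 6 * δ) N) ≤ |τ| →
      |τ| ≤ (N : ℝ) ^ (3 / 4 : ℝ) →
        ‖moebiusSum N (τ * I)‖ ≤ 50 * Real.sqrt N * |τ| ^ (1 / 2 - kappaExp τ) := by
  have hδ1' : δ ≤ 1 := by linarith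
  obtain ⟨D, T₁, hP1⟩ := h1
  obtain ⟨T₁₈, hP18⟩ := h18
  obtain ⟨C, D₂₀, T₂₀, hP20⟩ := h20
  have hP1' := Prop1With.mono_max hδ0 hP1
  have hP20' := Prop20With.mono_max hP20
  set D' := max D 0 with hD'
  set C' := max C 0 with hC'
  have hD0 : 0 ≤ D' := le_max_right _ _
  have hC0 : 0 ≤ C' := le_max_right _ _
  obtain ⟨t₁, ht₁⟩ := exists_goodSize T₁ T₁₈
  obtain ⟨t₂, ht₂⟩ := exists_goodCount δ D₂₀ (max T₂₀ 0)
  obtain ⟨t₃, ht₃⟩ := exists_midGood T₁ T₁₈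
  set tthr := max t₁ t₂ with htthr
  have hthr : ∀ t : ℝ, tthr ≤ t → GoodSize T₁ T₁₈ t ∧ GoodCount δ D₂₀ (max T₂₀ 0) t := fun t ht ↦
    ⟨ht₁ t (le_trans (le_max_left _ _) ht), ht₂ t (le_trans (le_max_right _ _) ht)⟩
  obtain ⟨Ca, hCa, M, hsmall⟩ := InvZetaSmallRH.exists_norm_inv_zeta_le_rpow_neg hRH (le_max_left 1 t₃)
  have hmid : ∀ t : ℝ, max 1 t₃ < t → MidGood T₁ T₁₈ t := fun t ht ↦
    ht₃ t (le_trans (le_max_right _ _) ht.le)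
  obtain ⟨N₁, hN₁⟩ := eventually_largeN δ D' C' D₂₀ Ca M tthr hδ0
  obtain ⟨KP, hKP, hPerron⟩ := norm_moebiusSum_twist_sub_perron_le
  obtain ⟨t₄, ht₄⟩ := exists_largeT δ (D' + 2) KP hδ0
  -- `exp(3Λ(N)) ≥ t₄` for `N` large
  obtain ⟨N₂, hN₂⟩ := Filter.eventually_atTop.1
    (((tendsto_lam (show (0 : ℝ) < 5 / 2 + 6 * δ by positivity)).const_mul_atTop
      (show (0 : ℝ) < 3 by norm_num)).eventually_ge_atTop (Real.log t₄))
  refine ⟨max N₁ (max N₂ 3), fun N hN τ hτ1 hτ2 ↦ ?_⟩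
  have hN₁N : N₁ ≤ N := le_trans (le_max_left _ _) hN
  have hN₂N : N₂ ≤ N := le_trans (le_trans (le_max_left _ _) (le_max_right _ _)) hN
  have hN3 : 3 ≤ N := le_trans (le_trans (le_max_right _ _) (le_max_right _ _)) hN
  have hL := hN₁ N hN₁N
  obtain ⟨hu22, hκ1, hκK, -, -, -, -, hTN, hNT, hN0⟩ := params hL
  set t := |τ| with htdef
  set Λ := lam (5 / 2 + 6 * δ) N with hΛdef
  -- `t` is large
  have ht₄t : t₄ ≤ t := by
    have h1 : Real.log t₄ ≤ 3 * Λ := hN₂ N hN₂N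
    rcases le_or_gt t₄ 0 with h0 | h0
    · exact h0.trans (abs_nonneg τ)
    · have : Real.exp (Real.log t₄) ≤ Real.exp (3 * Λ) := Real.exp_le_exp.2 h1
      rw [Real.exp_log h0] at this
      exact this.trans hτ1
  have hT : LargeT δ (D' + 2) KP t := ht₄ t ht₄t
  obtain ⟨ht1, hℓ16, hℓ₂0, hℓ₃0, h4ℓ, hℓ₃ℓ₂⟩ := largeT_sizes hT
  have ht0 : 0 < t := by linarith
  have hΛℓ : 3 * Λ ≤ Real.log t := by
    have := Real.log_le_log (Real.exp_pos _) hτ1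
    rwa [Real.log_exp] at this
  have hℓu : Real.log t ≤ 3 / 4 * Real.log N := by
    have := Real.log_le_log ht0 hτ2
    rwa [Real.log_rpow hN0] at this
  -- `t ≤ T/4`
  have hN4096 : (4096 : ℝ) ≤ N := by
    have : (2 : ℝ) ^ 32 ≤ N := by exact_mod_cast hL.Nbig
    linarith
  have hτT : |τ| ≤ ((bigT N : ℕ) : ℝ) / 4 := by
    have h1 : (N : ℝ) ^ (3 / 4 : ℝ) ≤ N / 8 := rpow_three_quarters_le hN4096
    have h2 : (N : ℝ) ≤ 2 * ((bigT N : ℕ) : ℝ) := by exact_mod_cast hNT.le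
    rw [← htdef]; linarith
  have hTx : ((bigT N : ℕ) : ℝ) ≤ (N : ℝ) + 1 / 2 := by
    have : ((bigT N : ℕ) : ℝ) ≤ N := by exact_mod_cast hTN
    linarith
  have hxT : ((N : ℝ) + 1 / 2) / 2 ≤ ((bigT N : ℕ) : ℝ) := by
    have : (N : ℝ) + 1 ≤ 2 * ((bigT N : ℕ) : ℝ) := by exact_mod_cast hNT
    linarith
  -- Perron and the contour
  have hP := hPerron N hN3 ((N : ℝ) + 1 / 2) (1 + 1 / Real.log ((N : ℝ) + 1 / 2)) rfl rfl
    ((bigT N : ℕ) : ℝ) hxT hTx τ hτT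
  have hB := perron_integral_le_of_largeN (τ := τ) hRH hδ0 hδ1' hD0 hP1' hP18 hL hthr hCa.le hsmall hmid
    (c := 1 + 1 / Real.log ((N : ℝ) + 1 / 2)) rfl hτT
  have hS := twisted_sum_le (KP := KP) hδ0 hδ1 hD0 hP18 hP20' hC0 hL hthr hT hΛℓ hℓu
  set B := ∫ u in (-((bigT N : ℕ) : ℝ))..((bigT N : ℕ) : ℝ),
    (riemannZeta ((1 + 1 / Real.log ((N : ℝ) + 1 / 2) : ℝ) + u * I))⁻¹ *
      ((((N : ℝ) + 1 / 2 : ℝ) : ℂ) ^ (((1 + 1 / Real.log ((N : ℝ) + 1 / 2) : ℝ) : ℂ) + u * I) /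
        (((1 + 1 / Real.log ((N : ℝ) + 1 / 2) : ℝ) : ℂ) + u * I - τ * I)) with hBdef
  -- numerics
  have hmaxD : max D' 0 = D' := max_eq_left hD0
  obtain ⟨hn1, hn2, hn3, hκ24⟩ := prop12_numerics hT hδ0 hδ1 hΛℓ
  set P := Real.exp ((1 / 2 - Real.log (Real.log (Real.log t)) / (2 * Real.log (Real.log t))) * Real.log t)
    with hPdef
  have hPeq : t ^ (1 / 2 - kappaExp τ) = P := by
    rw [hPdef, Real.rpow_def_of_pos ht0, kappaExp, ← htdef]; ring_nf
  have hP0 : 0 < P := Real.exp_pos _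
  -- `‖B‖ ≤ 147 √x P ≤ 294 √N P`
  have hsx0 : 0 ≤ Real.sqrt ((N : ℝ) + 1 / 2) := Real.sqrt_nonneg _
  have hsx : Real.sqrt ((N : ℝ) + 1 / 2) ≤ 2 * Real.sqrt N := by
    calc Real.sqrt ((N : ℝ) + 1 / 2) ≤ Real.sqrt (4 * N) := Real.sqrt_le_sqrt (by linarith)
      _ = 2 * Real.sqrt N := by
          rw [Real.sqrt_mul (by norm_num), show (4 : ℝ) = 2 ^ 2 by norm_num, Real.sqrt_sq (by norm_num)]
  have hsN0 : 0 ≤ Real.sqrt (N : ℝ) := Real.sqrt_nonneg _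
  have hB' : ‖B‖ ≤ 294 * Real.sqrt N * P := by
    have hS' : 24 * ∑ n ∈ Finset.Ico (nzero N) (bigT N),
        Real.exp (blockE δ (max D' 0 + 2) (Real.log ((N : ℝ) + 1 / 2)) n) *
          (1 / (1 + |(n : ℝ) - τ|) + 1 / (1 + |(n : ℝ) + τ|)) + Real.exp Λ ≤ 146 * P := by
      have hS2 := hS
      rw [hmaxD] at hS2 ⊢
      have hE0 : 0 ≤ Real.exp (Real.log t / 2 - (1 / 2 + 2 * δ) * Real.log t *
          Real.log (Real.log (Real.log t)) / Real.log (Real.log t)) := (Real.exp_pos _).le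
      have e24 : 24 * (Real.exp (Real.log t / 2 - (1 / 2 + 2 * δ) * Real.log t *
          Real.log (Real.log (Real.log t)) / Real.log (Real.log t)) * (2 * (1 + Real.log (t / 4 + 2)))) =
          48 * Real.exp (Real.log t / 2 - (1 / 2 + 2 * δ) * Real.log t *
            Real.log (Real.log (Real.log t)) / Real.log (Real.log t)) * (1 + Real.log (t / 4 + 2)) := by ring
      linarith [hn1, hn2, hn3, hS2, e24]
    exact normB_numerics hsx0 hsx hn3 hB hS'
  -- `‖(2π)⁻¹ x^{−iτ} B‖ ≤ ‖B‖/6`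
  have hx0 : (0 : ℝ) < (N : ℝ) + 1 / 2 := by linarith
  have hnormB := norm_perron_prefactor_le (τ := τ) hx0 B
  -- the Perron error `≤ √N P`
  have hKP' : KP * (1 + |τ|) * Real.log ((N : ℝ) + 1 / 2) ≤ Real.sqrt N * P := by
    obtain ⟨hLu, hLu1⟩ := log_x_bounds (N := N) (by
      have : Real.log (N : ℝ) ≤ (N : ℝ) - 1 := Real.log_le_sub_one_of_pos hN0
      linarith)
    have hΛ' : 3 * (Real.log N ^ (1 / 2 : ℝ) * Real.log (Real.log N) ^ (5 / 2 + 6 * δ)) ≤ Real.log t := by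
      rw [hΛdef] at hΛℓ; unfold lam at hΛℓ; exact hΛℓ
    have hsqrt : Real.exp (Real.log N / 2) = Real.sqrt N := by
      rw [Real.sqrt_eq_rpow, Real.rpow_def_of_pos hN0]; ring_nf
    have := perron_err_numerics hT hδ0 hδ1 hKP hu22 hΛ' hℓu hLu1 (Real.log_nonneg (by linarith))
    rw [hsqrt, ← hPdef] at this
    exact this
  -- conclude
  have hP' := hP
  have htri := norm_le_insert' (moebiusSum N ((τ : ℂ) * I))
    ((2 * π : ℂ)⁻¹ * (((N : ℝ) + 1 / 2 : ℝ) : ℂ) ^ (-((τ : ℂ) * I)) * B)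
  rw [hPeq]
  calc ‖moebiusSum N ((τ : ℂ) * I)‖
      ≤ ‖(2 * π : ℂ)⁻¹ * (((N : ℝ) + 1 / 2 : ℝ) : ℂ) ^ (-((τ : ℂ) * I)) * B‖ +
          ‖moebiusSum N ((τ : ℂ) * I) - (2 * π : ℂ)⁻¹ * (((N : ℝ) + 1 / 2 : ℝ) : ℂ) ^ (-((τ : ℂ) * I)) * B‖ := htri
    _ ≤ ‖B‖ / 6 + Real.sqrt N * P := add_le_add hnormB (hP'.trans hKP')
    _ ≤ 294 * Real.sqrt N * P / 6 + Real.sqrt N * P := by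
        have := div_le_div_of_nonneg_right hB' (by norm_num : (0 : ℝ) ≤ 6); linarith
    _ = 50 * Real.sqrt N * P := by ring

/-- **Balazard–de Roton 2010, Proposition 12, from the engine.** Under RH and the conclusions of
Balazard–de Roton 2008, Props. 1, 18, 20 at every level `δ ∈ (0,1]`: for `0 < δ ≤ 1/12` there are
`N₀`, `K > 0` with `‖M_N(iτ)‖ ≤ K √N |τ|^{1/2−κ(τ)}` whenever `N ≥ N₀` and
`exp(3(log N)^{1/2}(log log N)^{5/2+6δ}) ≤ |τ| ≤ N^{3/4}` — hypothesis `h12` of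
`BalazardDeRoton2010_thm1_of_deep` (with `K = 50`). [cite: BalazardDeRoton2010, Prop. 12] -/
theorem moebiusSum_twist_bound_of_engine (hRH : RiemannHypothesis)
    (h1 : ∀ δ : ℝ, 0 < δ → δ ≤ 1 / 12 → ∃ D T₀ : ℝ, Prop1With δ D T₀)
    (h18 : ∀ δ : ℝ, 0 < δ → δ ≤ 1 / 12 → ∃ T₀ : ℝ, Prop18With δ T₀)
    (h20 : ∀ δ : ℝ, 0 < δ → δ ≤ 1 / 12 → ∃ C D T₀ : ℝ, Prop20With δ C D T₀) :
    ∀ δ : ℝ, 0 < δ → δ ≤ 1 / 12 → ∃ (N₀ : ℕ) (K : ℝ), 0 < K ∧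
      ∀ N : ℕ, N₀ ≤ N → ∀ τ : ℝ, Real.exp (3 * eExp (5 / 2 + 6 * δ) N) ≤ |τ| →
        |τ| ≤ (N : ℝ) ^ (3 / 4 : ℝ) →
        ‖moebiusSum N (τ * I)‖ ≤ K * Real.sqrt N * |τ| ^ (1 / 2 - kappaExp τ) := by
  intro δ hδ0 hδ1
  obtain ⟨N₁, hN₁⟩ := exists_twist_nat_le hRH hδ0 hδ1 (h1 δ hδ0 hδ1) (h18 δ hδ0 hδ1) (h20 δ hδ0 hδ1)
  exact ⟨N₁, 50, by norm_num, fun N hN τ hτ1 hτ2 ↦ hN₁ N hN τ hτ1 hτ2⟩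

end assembly

end SoundContour

end Literature.NumberTheory.LFunctions

end
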